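import Summits.BirchSwinnertonDyer.BirchSwinnertonDyer.Theorems.RamifiedSevenEllipticUnitsBottomLocalIndexSplit
import Summits.BirchSwinnertonDyer.Rank1Residual.X12.O11.RamifiedRubinFormulaLineZp
import Summits.BirchSwinnertonDyer.BirchSwinnertonDyer.Theses.RamifiedSevenEllipticUnits
import HarnessLib

set_option linter.dupNamespace false
set_option autoImplicit false

/-!
# K7r crux `EllipticUnitValueSevenOfGZK` (stmt-BirchSwinnertonDyer-19945), line `rubin-formula-zp`:
# the stub S_B4′ `stub_bottomLocalIndexSplitSevenZp` — THE BOTTOM INDEX SPLITS OVER THE CORRECTED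
# CARRIER, `λ₀(D) = c + m_loc`, at EVERY O11 frame and EVERY prime (cell `bsd-cm`, seat `bsd-cm-k7r-c4`
# g6; `--supports` 19945)

HONEST FRAMING. This lands ONE stub of the registered line `rubin-formula-zp` (evidence on 19945:
`rubin-formula-zp.lean`, sha16 ec2fe70f5f36e40a; line card `rubin-formula-zp.md`) BY NAME: the typed input
`X12.O11.RamifiedCMBottomLocalIndexSplitAtZp W p` (`Rank1Residual/X12/O11/RamifiedRubinFormulaLineZp.lean`,
p467346) holds for every globally minimal `W/ℚ` and every prime `p` — it is pure index algebra over the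
`p`-adic carrier `𝒪_𝔭 · z(𝟙)` (`padicEndSpan`, D117): GIVEN a datum `D` with bottom index exponent `c`
(`D.HasBottomIndexExpZp c`), the saturation (sat) `S_{p,rel}(E/K) ≤ E(K) ⊗ ℤ_p`, the non-degeneracy (inj) of
`loc_𝔭` on `E(K) ⊗ ℤ_p` modulo torsion and a local Mordell–Weil exponent `m`, the local bottom exponent is
`λ₀(D) = c + m` — seat k7r-c4 g5's `BottomLocalIndexSplit.hasLocalBottomIndexExpZp_of_sat_of_inj` (p465731).
The crux itself (whose OPEN content is the analytic ramified Rubin formula, stub S_open, and the saturation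
stub S_sat) is NOT proved here; nothing is asserted about any curve; BSD is not claimed; a closed item
would close a rung leaf of BirchSwinnertonDyer at most.

References: [BKNO] A. Burungale, S. Kobayashi, K. Nakamura, K. Ota, arXiv:2608.06879v1 (2026) Lemma 7.1,
Thm. 7.2, §1.4 (objects only; preprint); B. Perrin-Riou, Bull. SMF 115 (1987) §0 pp. 401–402; cell memos
MEMO-k7r-c4-g5-CARRIER.md §5, `Lines/rubin-formula-zp.md`.
-/

noncomputable section

open scoped Classical

open WeierstrassCurve NumberField IsDedekindDomain Field
  Literature.NumberTheory.EllipticCurves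
  Literature.NumberTheory.EllipticCurves.Rank1Residual
  Literature.NumberTheory.EllipticCurves.BurungaleKobayashiNakamuraOta2026
  Summit.BirchSwinnertonDyer.Rank1Residual
  Summit.BirchSwinnertonDyer.Rank1Residual.X12

namespace Summit.BirchSwinnertonDyer.BirchSwinnertonDyer.Theorems.RamifiedSevenEllipticUnits

/-- **S_B4′ IS A THEOREM at every prime: `X12.O11.RamifiedCMBottomLocalIndexSplitAtZp W p` holds** for
every globally minimal `W/ℚ` and every prime `p` — over the corrected carrier the bottom index splits as
`λ₀(D) = c + m` given (sat), (inj) and a local Mordell–Weil exponent `m` (pure index algebra,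
`BottomLocalIndexSplit.hasLocalBottomIndexExpZp_of_sat_of_inj`; the frame, analytic-rank and
anticyclotomic binders are not used). [cite: PerrinRiou1987BSMF, §0 pp. 401–402 (the descent sequence `0 → E(L) ⊗ ℤ_p → S_p(L) → T_pШ → 0`)]
[cite: BurungaleKobayashiNakamuraOta2026, Lemma 7.1, Thm. 7.2 and §1.4 (arXiv:2608.06879 pp. 8, 40–41) (claim; preprint; shape only)] -/
theorem ramifiedCMBottomLocalIndexSplitAtZp_holds (W : WeierstrassCurve ℚ) [W.IsElliptic]
    [W.IsGloballyMinimal] (p : ℕ) [Fact p.Prime] : X12.O11.RamifiedCMBottomLocalIndexSplitAtZp W p := by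
  intro K _ _ 𝔭 W' _ _ C _ _ κ _ γ _ ι φ Ω 𝓔 D c hc hsat hinj m hm
  exact BottomLocalIndexSplit.hasLocalBottomIndexExpZp_of_sat_of_inj D hc hsat hinj hm

/-- **stub S_B4′** of the line `rubin-formula-zp` on crux `EllipticUnitValueSevenOfGZK`
(stmt-BirchSwinnertonDyer-19945): `λ₀(D) = c + m_loc` over the corrected carrier at the ramified prime `7`
for every globally minimal `W ∈ 𝒞₇` — PROVED (the case `p = 7` of `ramifiedCMBottomLocalIndexSplitAtZp_holds`;
the class hypothesis is not needed). Name and signature are those of the registered skeleton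
(`Lines/rubin-formula-zp.lean`, where the same term closes the stub inline). Closes no item by itself; BSD is
not claimed. [cite: PerrinRiou1987BSMF, §0 pp. 401–402 (the descent sequence)] -/
theorem stub_bottomLocalIndexSplitSevenZp :
    ∀ (W : WeierstrassCurve ℚ) [W.IsElliptic] [W.IsGloballyMinimal] [Fact (Nat.Prime 7)],
      X12.ClassCSeven W → X12.O11.RamifiedCMBottomLocalIndexSplitAtZp W 7 :=
  fun W _ _ _ _ ↦ ramifiedCMBottomLocalIndexSplitAtZp_holds W 7

end Summit.BirchSwinnertonDyer.BirchSwinnertonDyer.Theorems.RamifiedSevenEllipticUnits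

end
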